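import Summits.QuantumFields.YangMills.Theorems.F4SubCurvatureDoorBigOBudgetSharpnessWitness
import Summits.QuantumFields.YangMills.Theorems.LangevinControlUVOSLegsAtWeakCouplingCDefs
import Literature.MathematicalPhysics.QuantumLattice.LatticeScalarField
import HarnessLib

/-!
# «BIG-O BUDGET SHARPNESS» for crux ⟨stmt-QuantumFields-23035⟩ — the SYMMETRY clauses of the witness

Free-hands work of width seat `ym-line-sfw-p2-w3` (g37, cell `ym-idea-1`), part 2 of the owner's NEGATIVE TARGET
`Cruxes/ShortRootRigidity/BigOBudgetSharpnessTarget.lean` (ym-idea-3 g21).  The lattice form `3h₆ = 15‖x‖⁶ − Σ_{v ∈ D₄, ‖v‖²=2}⟪v,x⟫⁶`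
makes invariance under every isometry preserving the checkerboard lattice `D₄` a FINITE-SET argument: such an `R` maps the 24 minimal
vectors injectively into the norm-`√2` vectors of `D₄`, which ARE the 24 minimal vectors (`{−1,0,1}⁴`-enumeration, `decide`), hence
permutes them, and the sextic is a sum over that set.  Signed permutations of the axes preserve `D₄`, so `W(B₄)`-invariance follows.

* `witnessLatticeInvariant : WitnessLatticeInvariant`, `witnessSignedPermInvariant : WitnessSignedPermInvariant` (Props restated
  character-for-character from the target file).

NOT here: the reflection-positivity clause (Laplace–Fourier representation).  HONEST LABEL: sharpness bookkeeping about the HYPOTHESES of an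
OPEN crux; nothing of ⟨23035⟩, R2d or the Yang–Mills mass gap is proved by this.
-/

set_option autoImplicit false

noncomputable section

namespace Summit.QuantumFields.YangMills.Cruxes.ShortRootRigidity.Sharpness

open scoped BigOperators
open Finset
open Literature.MathematicalPhysics.QuantumLattice (siteToE siteToE_apply)
open Summit.QuantumFields.YangMills.Cruxes.OSLegsAtWeakCouplingC.Sketch (IsSignedPerm)

/-! ## The registered texts (verbatim from the target file) -/

/-- Witness clause: `W(B₄)` (signed permutation) invariance (verbatim). [problem-side target] -/
def WitnessSignedPermInvariant : Prop := ∀ R : E4 ≃ₗᵢ[ℝ] E4, IsSignedPerm R → ∀ x, bigOWitness (R x) = bigOWitness x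

/-- Witness clause: invariance under every isometry preserving `D₄` (verbatim). [problem-side target] -/
def WitnessLatticeInvariant : Prop :=
  ∀ R : E4 ≃ₗᵢ[ℝ] E4,
    (∀ z : Fin 4 → ℤ, Even (∑ i, z i) → ∃ w : Fin 4 → ℤ, Even (∑ i, w i) ∧ R (siteToE z) = siteToE w) →
    ∀ x, bigOWitness (R x) = bigOWitness x

/-! ## The 24 minimal vectors as a finite set -/

/-- The sign `±1 ∈ ℤ` encoded by a Boolean. -/
def sgnZ (a : Bool) : ℤ := if a then 1 else -1

/-- Integer coordinates of the minimal vector with index `t = (i, j, a, b)`: `±eᵢ ± eⱼ`. -/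
def zv (t : Fin 4 × Fin 4 × Bool × Bool) : Fin 4 → ℤ :=
  fun k => (if k = t.1 then sgnZ t.2.2.1 else 0) + (if k = t.2.1 then sgnZ t.2.2.2 else 0)

/-- The index set `{(i, j, a, b) : i < j}` of the 24 minimal vectors. -/
def T : Finset (Fin 4 × Fin 4 × Bool × Bool) := Finset.univ.filter (fun t => t.1 < t.2.1)

/-- The minimal vector with index `t`. -/
def rv (t : Fin 4 × Fin 4 × Bool × Bool) : E4 := rootVec t.1 t.2.1 t.2.2.1 t.2.2.2

/-- `rootVec` is the real image of the integer vector `zv`. -/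
theorem rv_eq_siteToE (t : Fin 4 × Fin 4 × Bool × Bool) : rv t = siteToE (zv t) := by
  obtain ⟨i, j, a, b⟩ := t
  ext k
  cases a <;> cases b <;> simp [rv, rootVec, e, zv, sgnZ, siteToE_apply] <;> split_ifs <;> norm_num

/-- The index map `zv` is injective on `T`. -/
theorem zv_injOn : ∀ t ∈ T, ∀ t' ∈ T, zv t = zv t' → t = t' := by decide

/-- Every minimal vector has even coordinate sum and squared norm `2`. -/
theorem zv_props : ∀ t ∈ T, Even (∑ k, zv t k) ∧ (∑ k, zv t k ^ 2) = 2 := by decide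

/-- The norm-`√2` vectors of `ℤ⁴` with entries in `{−1,0,1}` are minimal vectors. -/
theorem mem_image_zv_of_sq : ∀ w ∈ Fintype.piFinset (fun _ : Fin 4 => ({-1, 0, 1} : Finset ℤ)),
    (∑ k, w k ^ 2) = 2 → w ∈ T.image zv := by decide

/-- An integer vector with `Σ wₖ² = 2` is a minimal vector. -/
theorem mem_image_zv {w : Fin 4 → ℤ} (hw : (∑ k, w k ^ 2) = 2) : w ∈ T.image zv := by
  refine mem_image_zv_of_sq w ?_ hw
  rw [Fintype.mem_piFinset]
  intro k
  have hk : w k ^ 2 ≤ 2 := by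
    rw [← hw]
    exact Finset.single_le_sum (f := fun k => w k ^ 2) (fun _ _ => sq_nonneg _) (Finset.mem_univ k)
  have h1 : w k ≤ 1 := by nlinarith
  have h2 : -1 ≤ w k := by nlinarith
  simp only [Finset.mem_insert, Finset.mem_singleton]
  omega

/-- `siteToE` is injective. -/
theorem siteToE_injective' : Function.Injective (siteToE (d := 4)) := by
  intro z z' h
  funext k
  have := congrArg (fun v : E4 => v k) h
  simpa [siteToE_apply] using this

/-- The squared norm of an integer vector. -/
theorem norm_sq_siteToE (w : Fin 4 → ℤ) : ‖siteToE w‖ ^ 2 = ((∑ k, w k ^ 2 : ℤ) : ℝ) := by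
  rw [norm_sq_E4]
  push_cast
  simp [siteToE_apply, Fin.sum_univ_four]

/-- The lattice sextic is the sum of `⟪v,x⟫⁶` over the index set `T`. -/
theorem rootSextic_eq_sum_T (x : E4) : rootSextic x = ∑ t ∈ T, (inner ℝ (rv t) x) ^ 6 := by
  rw [T, Finset.sum_filter, rootSextic, Fintype.sum_prod_type]
  refine Finset.sum_congr rfl fun i _ => ?_
  rw [Fintype.sum_prod_type]
  refine Finset.sum_congr rfl fun j _ => ?_
  rw [Fintype.sum_prod_type, Fintype.sum_bool, Fintype.sum_bool, Fintype.sum_bool]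
  simp only [rv]
  split_ifs <;> ring

/-- The lattice sextic as a sum over the finite SET of minimal vectors. -/
theorem rootSextic_eq_sum_image (x : E4) : rootSextic x = ∑ v ∈ T.image rv, (inner ℝ v x) ^ 6 := by
  classical
  rw [rootSextic_eq_sum_T, Finset.sum_image]
  intro t ht t' ht' h
  refine zv_injOn t ht t' ht' (siteToE_injective' ?_)
  rw [← rv_eq_siteToE, ← rv_eq_siteToE, h]

/-! ## Lattice-preserving isometries permute the minimal vectors -/

/-- A `D₄`-preserving isometry maps minimal vectors to minimal vectors. -/
theorem image_rv_subset {R : E4 ≃ₗᵢ[ℝ] E4}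
    (hR : ∀ z : Fin 4 → ℤ, Even (∑ i, z i) → ∃ w : Fin 4 → ℤ, Even (∑ i, w i) ∧ R (siteToE z) = siteToE w) :
    ∀ v ∈ T.image rv, R v ∈ T.image rv := by
  classical
  intro v hv
  obtain ⟨t, ht, rfl⟩ := Finset.mem_image.1 hv
  obtain ⟨heven, hsq⟩ := zv_props t ht
  obtain ⟨w, -, hw⟩ := hR (zv t) heven
  rw [rv_eq_siteToE, hw]
  have hnorm : ((∑ k, w k ^ 2 : ℤ) : ℝ) = ((∑ k, zv t k ^ 2 : ℤ) : ℝ) := by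
    rw [← norm_sq_siteToE, ← norm_sq_siteToE, ← hw, LinearIsometryEquiv.norm_map]
  have hw2 : (∑ k, w k ^ 2) = 2 := by
    have := hnorm; rw [hsq] at this; exact_mod_cast this
  obtain ⟨t', ht', hzt'⟩ := Finset.mem_image.1 (mem_image_zv hw2)
  exact Finset.mem_image.2 ⟨t', ht', by rw [rv_eq_siteToE, hzt']⟩

/-- **Invariance of the lattice sextic under every `D₄`-preserving isometry.** -/
theorem rootSextic_map_of_lattice {R : E4 ≃ₗᵢ[ℝ] E4}
    (hR : ∀ z : Fin 4 → ℤ, Even (∑ i, z i) → ∃ w : Fin 4 → ℤ, Even (∑ i, w i) ∧ R (siteToE z) = siteToE w)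
    (x : E4) : rootSextic (R x) = rootSextic x := by
  classical
  set S : Finset E4 := T.image rv with hS
  -- `R` permutes `S`
  have hsub : S.image R ⊆ S := by
    intro v hv
    obtain ⟨u, hu, rfl⟩ := Finset.mem_image.1 hv
    exact image_rv_subset hR u hu
  have hcard : (S.image R).card = S.card := Finset.card_image_of_injective _ R.injective
  have heq : S.image R = S := Finset.eq_of_subset_of_card_le hsub hcard.ge
  rw [rootSextic_eq_sum_image, rootSextic_eq_sum_image, ← hS]
  conv_lhs => rw [← heq]
  rw [Finset.sum_image fun u _ v _ h => R.injective h]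
  refine Finset.sum_congr rfl fun u _ => ?_
  rw [LinearIsometryEquiv.inner_map_map]

/-- **`WitnessLatticeInvariant`**: the witness is invariant under every isometry preserving `D₄`. -/
theorem witnessLatticeInvariant : WitnessLatticeInvariant := by
  intro R hR x
  rw [bigOWitness, bigOWitness, h6three, h6three, rootSextic_map_of_lattice hR, LinearIsometryEquiv.norm_map]

/-! ## Signed permutations preserve `D₄` -/

/-- An integer vector is the integer combination of the coordinate vectors. -/
theorem siteToE_eq_sum (z : Fin 4 → ℤ) : siteToE z = ∑ i, (z i : ℝ) • e i := by
  ext k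
  simp [siteToE_apply, e, Fin.sum_univ_four]
  fin_cases k <;> simp

/-- **Signed permutations preserve the checkerboard lattice** (with parity of the coordinate sum). -/
theorem lattice_of_isSignedPerm {R : E4 ≃ₗᵢ[ℝ] E4} (hR : IsSignedPerm R) :
    ∀ z : Fin 4 → ℤ, Even (∑ i, z i) → ∃ w : Fin 4 → ℤ, Even (∑ i, w i) ∧ R (siteToE z) = siteToE w := by
  classical
  -- choose the permutation data: `R eᵢ = sᵢ • e_{jᵢ}`, `sᵢ = ±1`
  have hc : ∀ i : Fin 4, ∃ (j : Fin 4) (s : ℤ), (s = 1 ∨ s = -1) ∧ R (e i) = (s : ℝ) • e j := by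
    intro i
    obtain ⟨j, hj | hj⟩ := hR i
    · exact ⟨j, 1, Or.inl rfl, by rw [e, hj]; simp [e]⟩
    · exact ⟨j, -1, Or.inr rfl, by rw [e, hj]; simp [e]⟩
  choose j s hs hRe using hc
  intro z hz
  refine ⟨fun k => ∑ i, if j i = k then s i * z i else 0, ?_, ?_⟩
  · -- parity: `Σ_k w_k = Σ_i sᵢ zᵢ ≡ Σ zᵢ (mod 2)`
    have hsum : (∑ k, ∑ i, if j i = k then s i * z i else 0) = ∑ i, s i * z i := by
      rw [Finset.sum_comm]
      refine Finset.sum_congr rfl fun i _ => ?_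
      rw [Finset.sum_ite_eq, if_pos (Finset.mem_univ _)]
    rw [hsum]
    have hdiff : Even (∑ i, s i * z i - ∑ i, z i) := by
      rw [← Finset.sum_sub_distrib]
      refine Finset.even_sum _ fun i _ => ?_
      rcases hs i with h | h
      · rw [h]; simp
      · rw [h]; rw [show (-1 : ℤ) * z i - z i = -(2 * z i) by ring]; exact (even_two_mul _).neg
    exact (Int.even_sub.1 hdiff).2 hz
  · rw [siteToE_eq_sum, map_sum]
    simp_rw [map_smul, hRe, smul_smul]
    rw [siteToE_eq_sum]
    -- compare coefficients of `e k`
    have : ∀ i, ((z i : ℝ) * (s i : ℝ)) • e (j i) = ∑ k, (if j i = k then ((s i * z i : ℤ) : ℝ) else 0) • e k := by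
      intro i
      rw [Finset.sum_eq_single (j i) (fun k _ hk => by rw [if_neg (Ne.symm hk), zero_smul]) (fun h => absurd (Finset.mem_univ _) h),
        if_pos rfl]
      push_cast; ring_nf
    simp_rw [this]
    rw [Finset.sum_comm]
    refine Finset.sum_congr rfl fun k _ => ?_
    rw [← Finset.sum_smul]
    congr 1
    push_cast
    rfl

/-- **`WitnessSignedPermInvariant`**: the witness is `W(B₄)`-invariant. -/
theorem witnessSignedPermInvariant : WitnessSignedPermInvariant :=
  fun R hR x => witnessLatticeInvariant R (lattice_of_isSignedPerm hR) x

end Summit.QuantumFields.YangMills.Cruxes.ShortRootRigidity.Sharpness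

end
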